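import Summits.KontsevichZagierPeriods.KontsevichZagierPeriods.Theorems.RootDecompWalshStrataConicNeg

/-!
# Conic descent 4/7: the cells with `A = 0` and `A > 0`; conic normal form; the stratum modulo `SqrtDescent`

**`inBaker_cell_of_zero`** (`A = 0`: `B(x)·y + C(x) > 0` is three bands with rational edges
`−C/B`, clamped, over the sign pieces of `B`), **`inBaker_cell_of_pos`** (`A > 0`: rule (1a)
complement `[cell(p)] = [(0,1)²] − [cell(−p)] − [{p = 0}]`, the conic being null),
**`exists_conic_of_totalDegree_le_two`** (every `P ∈ ℚ[x,y]` of total degree ≤ 2 is a `Conic`,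
via `Finset.sum_induction` over `P.as_sum`) and **`quadricBakerDescent_two_of_sqrtDescent`**:
`QuadricBakerDescent∣d≤2` follows from `∀ e f g γ, SqrtDescent e f g γ` (`d = 0, 1` immediate).
Imports: part 3; 0 sorry. [KontsevichZagier2001 §1.2; BCR1998 §2.2]
-/

noncomputable section

open Literature.NumberTheory.Transcendental
open MeasureTheory Set
open MvPolynomial (aeval X C)
open Literature.ModelTheory.ExponentialFields (IsSemialgebraic isSemialgebraic_univ
  isSemialgebraic_setOf_eval_pos isSemialgebraic_setOf_eval_lt isSemialgebraic_setOf_eval_le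
  isSemialgebraic_setOf_eval_nonneg isSemialgebraic_setOf_eval_eq_zero continuous_aeval_real
  tarski_seidenberg_real_holds)
open Summit.KontsevichZagierPeriods.RootDecompWalshStrata.WalshSpanProof (isSemialgebraic_cubeSet
  isBounded_cubeSet)
open Summit.KontsevichZagierPeriods.RootDecompWalshStrata.ConeSpecimen (unitIoo isSemialgebraic_unitIoo
  unitIoo_subset_Icc mem_unitIoo)

namespace Summit.KontsevichZagierPeriods.RootDecompWalshStrata.ConicDescent

/-- `Fin.init z 0 = z 0` on `Fin 2` (private per-file copy; a verbatim twin is landed elsewhere in the tree). [folklore] -/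
@[simp] private theorem init_apply_zero₂ (z : Fin 2 → ℝ) : Fin.init z 0 = z 0 := rfl

/-- `Fin.last 1 = 1` in `Fin 2` (private per-file copy; a verbatim twin is landed elsewhere in the tree). [folklore] -/
@[simp] private theorem last_one₂ : (Fin.last 1 : Fin 2) = 1 := rfl

/-- The constant function `1` is `ℚ`-semialgebraic on a `ℚ`-semialgebraic set (private per-file copy; a verbatim twin is landed elsewhere in the tree). [BCR1998 §2.2] -/
private theorem isSemialgebraicFunOn_one {N : ℕ} {X : Set (Fin N → ℝ)} (hX : IsSemialgebraic ℚ X) :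
    IsSemialgebraicFunOn ℚ X fun _ => (1 : ℝ) :=
  (isSemialgebraicFunOn_ratCast hX 1).congr fun _ _ => Rat.cast_one

/-- The constant function `0` is `ℚ`-semialgebraic on a `ℚ`-semialgebraic set (private per-file copy; a verbatim twin is landed elsewhere in the tree). [BCR1998 §2.2] -/
private theorem isSemialgebraicFunOn_zero {N : ℕ} {X : Set (Fin N → ℝ)} (hX : IsSemialgebraic ℚ X) :
    IsSemialgebraicFunOn ℚ X fun _ => (0 : ℝ) :=
  (isSemialgebraicFunOn_ratCast hX 0).congr fun _ _ => Rat.cast_zero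

/-! #### 8. The conic cell with `A = 0`: three bands -/

/-- **`A = 0`.** The weighted cell of `B(x)·y + C(x) > 0` in `(0,1)²` lands in the Baker sector:
over `{B > 0}` it is the band `κ(−C/B) < y < 1`, over `{B < 0}` the band `0 < y < κ(−C/B)`, over
`{B = 0, C > 0}` the full fibre; rule (3) and clamp descent leave rational functions `±qC/B`.
[KontsevichZagier2001 §1.2; this node] -/
theorem inBaker_cell_of_zero (K : Conic) (hA : K.A = 0) (q : ℚ) (ρ : KZ.IntegralRep 2)
    (hdom : ρ.domain = K.cell) (hint : ∀ z ∈ ρ.domain, ρ.integrand z = q) : InBaker (KZ.of ρ) := by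
  have hA0 : (K.A : ℝ) = 0 := by exact_mod_cast hA
  have hp : ∀ x y : ℝ, K.pxy x y = K.Bx x * y + K.Cx x := fun x y => by
    simp only [Conic.pxy, hA0]; ring
  -- bases
  set Xp : Set (Fin 1 → ℝ) := {v | v ∈ unitIoo ∧ 0 < K.Bx (v 0)} with hXpdef
  set Xm : Set (Fin 1 → ℝ) := {v | v ∈ unitIoo ∧ K.Bx (v 0) < 0} with hXmdef
  set X0 : Set (Fin 1 → ℝ) := {v | v ∈ unitIoo ∧ K.Bx (v 0) = 0 ∧ 0 < K.Cx (v 0)} with hX0def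
  have hXp : IsSemialgebraic ℚ Xp :=
    IsSemialgebraicFunOn.isSemialgebraic_sep_pos (K.isSemialgebraicFunOn_Bx isSemialgebraic_unitIoo)
  have hXm : IsSemialgebraic ℚ Xm :=
    IsSemialgebraicFunOn.isSemialgebraic_sep_neg (K.isSemialgebraicFunOn_Bx isSemialgebraic_unitIoo)
  have hX0 : IsSemialgebraic ℚ X0 := by
    have h := (IsSemialgebraicFunOn.isSemialgebraic_sep_pos
      (K.isSemialgebraicFunOn_Cx isSemialgebraic_unitIoo)).inter
      (isSemialgebraic_setOf_eval_eq_zero (R := ℝ) K.Bp)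
    convert h using 1
    ext v
    simp only [hX0def, mem_setOf_eq, mem_inter_iff, Conic.aeval_Bp]
    tauto
  have hXpI : Xp ⊆ Icc 0 1 := fun v hv => unitIoo_subset_Icc hv.1
  have hXmI : Xm ⊆ Icc 0 1 := fun v hv => unitIoo_subset_Icc hv.1
  have hX0I : X0 ⊆ Icc 0 1 := fun v hv => unitIoo_subset_Icc hv.1
  -- the edge `r = −C/B`
  have hrf : ∀ {X : Set (Fin 1 → ℝ)}, IsSemialgebraic ℚ X → (∀ v ∈ X, K.Bx (v 0) ≠ 0) →
      IsSemialgebraicFunOn ℚ X fun v => -K.Cx (v 0) / K.Bx (v 0) := fun hX hB =>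
    (isSemialgebraicFunOn_aeval_div_aeval hX (-K.Cp) K.Bp fun v hv => by
      rw [Conic.aeval_Bp]; exact hB v hv).congr fun v _ => by simp
  have hrp : IsSemialgebraicFunOn ℚ Xp fun v => clamp (-K.Cx (v 0) / K.Bx (v 0)) :=
    IsSemialgebraicFunOn.clamp hXp (hrf hXp fun v hv => hv.2.ne')
  have hrm : IsSemialgebraicFunOn ℚ Xm fun v => clamp (-K.Cx (v 0) / K.Bx (v 0)) :=
    IsSemialgebraicFunOn.clamp hXm (hrf hXm fun v hv => hv.2.ne)
  -- the three pieces
  set Pp : Set (Fin 2 → ℝ) := oband Xp (fun v => clamp (-K.Cx (v 0) / K.Bx (v 0))) fun _ => 1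
    with hPpdef
  set Pm : Set (Fin 2 → ℝ) := oband Xm (fun _ => 0) fun v => clamp (-K.Cx (v 0) / K.Bx (v 0))
    with hPmdef
  set P0 : Set (Fin 2 → ℝ) := oband X0 (fun _ => 0) fun _ => 1 with hP0def
  have hPp : IsSemialgebraic ℚ Pp := isSemialgebraic_oband hrp (isSemialgebraicFunOn_one hXp)
  have hPm : IsSemialgebraic ℚ Pm := isSemialgebraic_oband (isSemialgebraicFunOn_zero hXm) hrm
  have hP0 : IsSemialgebraic ℚ P0 :=
    isSemialgebraic_oband (isSemialgebraicFunOn_zero hX0) (isSemialgebraicFunOn_one hX0)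
  -- the cell is their disjoint union
  -- membership unfoldings
  have mPp : ∀ z : Fin 2 → ℝ, z ∈ Pp ↔ ((0 < z 0 ∧ z 0 < 1) ∧ 0 < K.Bx (z 0)) ∧
      clamp (-K.Cx (z 0) / K.Bx (z 0)) < z 1 ∧ z 1 < 1 := fun z => by
    simp only [hPpdef, mem_oband, hXpdef, mem_setOf_eq, mem_unitIoo, init_apply_zero₂, last_one₂]
  have mPm : ∀ z : Fin 2 → ℝ, z ∈ Pm ↔ ((0 < z 0 ∧ z 0 < 1) ∧ K.Bx (z 0) < 0) ∧
      0 < z 1 ∧ z 1 < clamp (-K.Cx (z 0) / K.Bx (z 0)) := fun z => by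
    simp only [hPmdef, mem_oband, hXmdef, mem_setOf_eq, mem_unitIoo, init_apply_zero₂, last_one₂]
  have mP0 : ∀ z : Fin 2 → ℝ, z ∈ P0 ↔ ((0 < z 0 ∧ z 0 < 1) ∧ K.Bx (z 0) = 0 ∧ 0 < K.Cx (z 0)) ∧
      0 < z 1 ∧ z 1 < 1 := fun z => by
    simp only [hP0def, mem_oband, hX0def, mem_setOf_eq, mem_unitIoo, init_apply_zero₂, last_one₂]
  have mcell : ∀ z : Fin 2 → ℝ, z ∈ K.cell ↔ ((0 < z 0 ∧ z 0 < 1) ∧ (0 < z 1 ∧ z 1 < 1)) ∧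
      0 < K.Bx (z 0) * z 1 + K.Cx (z 0) := fun z => by
    simp only [Conic.cell, mem_setOf_eq, forall_fin_two_iff, hp]
  have hcov : ρ.domain = Pp ∪ (Pm ∪ P0) := by
    rw [hdom]
    ext z
    rw [mem_union, mem_union, mPp, mPm, mP0, mcell]
    constructor
    · rintro ⟨⟨hx, hy⟩, hpos⟩
      rcases lt_trichotomy (K.Bx (z 0)) 0 with hB | hB | hB
      · refine Or.inr (Or.inl ⟨⟨hx, hB⟩, hy.1, (lt_clamp_iff hy.1 hy.2).2 ?_⟩)
        rw [lt_div_iff_of_neg hB]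
        linarith
      · refine Or.inr (Or.inr ⟨⟨hx, hB, ?_⟩, hy.1, hy.2⟩)
        simpa [hB] using hpos
      · refine Or.inl ⟨⟨hx, hB⟩, (clamp_lt_iff hy.1 hy.2).2 ?_, hy.2⟩
        rw [div_lt_iff₀ hB]
        linarith
    · rintro (⟨⟨hx, hB⟩, h1, h2⟩ | ⟨⟨hx, hB⟩, h1, h2⟩ | ⟨⟨hx, hB, hC⟩, h1, h2⟩)
      · have hy0 : 0 < z 1 := (clamp_nonneg _).trans_lt h1
        have h1' := (clamp_lt_iff hy0 h2).1 h1
        rw [div_lt_iff₀ hB] at h1'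
        exact ⟨⟨hx, hy0, h2⟩, by linarith⟩
      · have hy1 : z 1 < 1 := h2.trans_le (clamp_le_one _)
        have h2' := (lt_clamp_iff h1 hy1).1 h2
        rw [lt_div_iff_of_neg hB] at h2'
        exact ⟨⟨hx, h1, hy1⟩, by linarith⟩
      · refine ⟨⟨hx, h1, h2⟩, ?_⟩
        rw [hB, zero_mul, zero_add]
        exact hC
  have hPpr : Pp ⊆ ρ.domain := fun z hz => hcov ▸ Or.inl hz
  have hPm0r : Pm ∪ P0 ⊆ ρ.domain := fun z hz => hcov ▸ Or.inr hz
  refine InBaker.of_split ρ hPp (hPm.union hP0) hPpr hPm0r hcov ?_ ?_ ?_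
  · have : Pp ∩ (Pm ∪ P0) = ∅ := by
      ext z
      refine ⟨fun hz => ?_, fun h => h.elim⟩
      obtain ⟨hz1, hz2⟩ := hz
      rw [mPp] at hz1
      rcases hz2 with hz2 | hz2
      · rw [mPm] at hz2
        exact False.elim (by linarith [hz1.1.2, hz2.1.2])
      · rw [mP0] at hz2
        exact False.elim (by linarith [hz1.1.2, hz2.1.2.1])
    rw [this, measure_empty]
  · -- over `{B > 0}`: the band `κ(−C/B) < y < 1`
    refine InBaker.of_band _ Xp hXp hXpI _ _ hrp (isSemialgebraicFunOn_one hXp)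
      (fun v _ => clamp_nonneg _) (fun v _ => clamp_le_one _) (fun _ _ => le_rfl) q rfl
      (fun z hz => hint z (hPpr hz)) ?_
    refine InBaker.of_sub' _ (polyRep₁ Xp hXp hXpI (MvPolynomial.C q)) rfl
      (InBaker.of_eqOn_aeval _ _ fun v _ => rfl) ?_
    refine InBaker.clamp_descent hXp (hrf hXp fun v hv => hv.2.ne') (-q) (fun r₁ hr₁ hr₁i => ?_) _
      rfl fun v _ => by
        simp only [subRep_integrand, lenRep, bddRep_integrand, polyRep₁_integrand,
          MvPolynomial.aeval_C, eq_ratCast]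
        push_cast; ring
    refine InBaker.of_eqOn_aeval_div r₁ (MvPolynomial.C q * K.Cp) K.Bp
      (fun v hv => by rw [Conic.aeval_Bp]; rw [hr₁] at hv; exact hv.1.2.ne') fun v hv => ?_
    have hB : K.Bx (v 0) ≠ 0 := by rw [hr₁] at hv; exact hv.1.2.ne'
    rw [hr₁i hv]
    simp only [map_mul, MvPolynomial.aeval_C, eq_ratCast, Conic.aeval_Bp, Conic.aeval_Cp]
    push_cast
    field_simp
  refine InBaker.of_split _ hPm hP0 (fun z hz => Or.inl hz) (fun z hz => Or.inr hz) rfl ?_ ?_ ?_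
  · have : Pm ∩ P0 = ∅ := by
      ext z
      refine ⟨fun hz => ?_, fun h => h.elim⟩
      obtain ⟨hz1, hz2⟩ := hz
      rw [mPm] at hz1
      rw [mP0] at hz2
      exact False.elim (by linarith [hz1.1.2, hz2.1.2.1])
    rw [this, measure_empty]
  · -- over `{B < 0}`: the band `0 < y < κ(−C/B)`
    refine InBaker.of_band _ Xm hXm hXmI _ _ (isSemialgebraicFunOn_zero hXm) hrm
      (fun _ _ => le_rfl) (fun v _ => clamp_nonneg _) (fun v _ => clamp_le_one _) q rfl
      (fun z hz => hint z (hPm0r (Or.inl hz))) ?_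
    refine InBaker.clamp_descent hXm (hrf hXm fun v hv => hv.2.ne) q (fun r₁ hr₁ hr₁i => ?_) _
      rfl fun v _ => by simp only [lenRep, bddRep_integrand, sub_zero]
    refine InBaker.of_eqOn_aeval_div r₁ (MvPolynomial.C (-q) * K.Cp) K.Bp
      (fun v hv => by rw [Conic.aeval_Bp]; rw [hr₁] at hv; exact hv.1.2.ne) fun v hv => ?_
    have hB : K.Bx (v 0) ≠ 0 := by rw [hr₁] at hv; exact hv.1.2.ne
    rw [hr₁i hv]
    simp only [map_mul, MvPolynomial.aeval_C, eq_ratCast, Conic.aeval_Bp, Conic.aeval_Cp]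
    push_cast
    field_simp
  · -- over `{B = 0, C > 0}`: the full fibre
    refine InBaker.of_band _ X0 hX0 hX0I _ _ (isSemialgebraicFunOn_zero hX0)
      (isSemialgebraicFunOn_one hX0) (fun _ _ => le_rfl) (fun _ _ => zero_le_one)
      (fun _ _ => le_rfl) q rfl (fun z hz => hint z (hPm0r (Or.inr hz))) ?_
    exact InBaker.of_eqOn_ratCast _ q fun v _ => by simp [lenRep]

/-! #### 9. The conic cell with `A > 0`: complement of the `A < 0` cell in the square -/

/-- **`A > 0`.** `[cell(p), q] = [(0,1)², q] − [cell(−p), q] − [{p = 0}, q]` (rule 1a): the square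
is a band over `(0,1)`, `−p` has `A < 0`, and the conic `{p = 0}` is null (two root graphs).
[KontsevichZagier2001 §1.2; this node] -/
theorem inBaker_cell_of_pos (K : Conic) (hA : 0 < K.A) (q : ℚ)
    (hS : ∀ γ : ℚ, SqrtDescent K.e K.f K.g γ) (ρ : KZ.IntegralRep 2) (hdom : ρ.domain = K.cell)
    (hint : ∀ z ∈ ρ.domain, ρ.integrand z = q) : InBaker (KZ.of ρ) := by
  have hAne : K.A ≠ 0 := hA.ne'
  -- the square
  set cube : Set (Fin 2 → ℝ) := {z | ∀ j, 0 < z j ∧ z j < 1} with hcubedef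
  have hcube : IsSemialgebraic ℚ cube := isSemialgebraic_cubeSet 2
  have hcubeI : cube ⊆ Icc 0 1 := fun z hz => ⟨fun j => (hz j).1.le, fun j => (hz j).2.le⟩
  set ρ' : KZ.IntegralRep 2 := polyRep₁ cube hcube hcubeI (MvPolynomial.C q) with hρ'def
  have hρ'i : ∀ z, ρ'.integrand z = q := fun z => by simp [hρ'def]
  have hsq : InBaker (KZ.of ρ') := by
    refine InBaker.of_band ρ' unitIoo isSemialgebraic_unitIoo unitIoo_subset_Icc (fun _ => 0)
      (fun _ => 1) (isSemialgebraicFunOn_zero isSemialgebraic_unitIoo)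
      (isSemialgebraicFunOn_one isSemialgebraic_unitIoo) (fun _ _ => le_rfl)
      (fun _ _ => zero_le_one) (fun _ _ => le_rfl) q ?_ (fun z _ => hρ'i z) ?_
    · ext z
      simp only [hρ'def, polyRep₁_domain, hcubedef, mem_setOf_eq, mem_oband, mem_unitIoo,
        init_apply_zero₂, forall_fin_two_iff]
      rfl
    · exact InBaker.of_eqOn_ratCast _ q fun v _ => by simp [lenRep]
  -- the three pieces of the square
  set A₃ : Set (Fin 2 → ℝ) := {z | z ∈ cube ∧ K.pxy (z 0) (z 1) = 0} with hA₃def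
  have hA₁ : IsSemialgebraic ℚ K.cell := K.isSemialgebraic_cell
  have hA₂ : IsSemialgebraic ℚ K.neg.cell := K.neg.isSemialgebraic_cell
  have hA₃ : IsSemialgebraic ℚ A₃ := by
    convert hcube.inter (isSemialgebraic_setOf_eval_eq_zero (R := ℝ) K.Pp) using 1
    ext z
    simp only [hA₃def, mem_setOf_eq, mem_inter_iff, Conic.aeval_Pp]
  have hcov : ρ'.domain = K.cell ∪ (K.neg.cell ∪ A₃) := by
    ext z
    simp only [hρ'def, polyRep₁_domain, mem_union, Conic.cell, hA₃def, mem_setOf_eq, Conic.neg_pxy,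
      hcubedef]
    constructor
    · intro hz
      rcases lt_trichotomy (K.pxy (z 0) (z 1)) 0 with h | h | h
      · exact Or.inr (Or.inl ⟨hz, by linarith⟩)
      · exact Or.inr (Or.inr ⟨hz, h⟩)
      · exact Or.inl ⟨hz, h⟩
    · rintro (⟨hz, _⟩ | ⟨hz, _⟩ | ⟨hz, _⟩) <;> exact hz
  have h1r : K.cell ⊆ ρ'.domain := fun z hz => hcov ▸ Or.inl hz
  have h23r : K.neg.cell ∪ A₃ ⊆ ρ'.domain := fun z hz => hcov ▸ Or.inr hz
  have hrel := of_sub_restrict_sub_restrict_mem_relations ρ' hA₁ (hA₂.union hA₃) h1r h23r hcov (by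
    have : K.cell ∩ (K.neg.cell ∪ A₃) = ∅ := by
      ext z
      refine ⟨fun hz => ?_, fun h => h.elim⟩
      obtain ⟨hz1, hz2⟩ := hz
      have hp1 : 0 < K.pxy (z 0) (z 1) := hz1.2
      rcases hz2 with hz2 | hz2
      · have hp2 : 0 < K.neg.pxy (z 0) (z 1) := hz2.2
        rw [Conic.neg_pxy] at hp2
        exact False.elim (by linarith)
      · have hp2 : K.pxy (z 0) (z 1) = 0 := hz2.2
        exact False.elim (by linarith)
    rw [this, measure_empty])
  -- the null conic
  have hvol₃ : volume A₃ = 0 := by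
    have hG₁ := KZ.volume_graph_eq_zero (K.isSemialgebraicFunOn_lox isSemialgebraic_unitIoo)
    have hG₂ := KZ.volume_graph_eq_zero (K.isSemialgebraicFunOn_hix isSemialgebraic_unitIoo)
    refine measure_mono_null (fun z hz => ?_) (measure_union_null hG₁ hG₂)
    simp only [hA₃def, hcubedef, mem_setOf_eq, forall_fin_two_iff] at hz
    obtain ⟨⟨hx, _⟩, hpz⟩ := hz
    have hxI : Fin.init z ∈ unitIoo := by rw [mem_unitIoo, init_apply_zero₂]; exact hx
    rcases (K.eq_root_of_eq_zero hAne _ _ hpz).2 with h | h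
    · exact Or.inl ⟨hxI, by simpa using h⟩
    · exact Or.inr ⟨hxI, by simpa using h⟩
  have h23 : InBaker (KZ.of (ρ'.restrict _ (hA₂.union hA₃) h23r)) := by
    refine InBaker.of_split _ hA₂ hA₃ (fun z hz => Or.inl hz) (fun z hz => Or.inr hz) rfl ?_ ?_ ?_
    · have : K.neg.cell ∩ A₃ = ∅ := by
        ext z
        refine ⟨fun hz => ?_, fun h => h.elim⟩
        obtain ⟨hz1, hz2⟩ := hz
        have hp1 : 0 < K.neg.pxy (z 0) (z 1) := hz1.2
        rw [Conic.neg_pxy] at hp1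
        have hp2 : K.pxy (z 0) (z 1) = 0 := hz2.2
        exact False.elim (by linarith)
      rw [this, measure_empty]
    · have hA' : K.neg.A < 0 := by change -K.A < 0; linarith
      refine inBaker_cell_of_neg K.neg hA' q ?_ _ rfl fun z _ => hρ'i z
      rw [Conic.neg_e, Conic.neg_f, Conic.neg_g]
      exact hS
    · exact InBaker.of_mem_relations (KZ.of_mem_relations_of_volume_eq_zero _ hvol₃)
  have h1 : InBaker (KZ.of (ρ'.restrict _ hA₁ h1r)) := by
    refine (hsq.sub h23).congr ?_
    have : KZ.of (ρ'.restrict _ hA₁ h1r) - (KZ.of ρ' - KZ.of (ρ'.restrict _ (hA₂.union hA₃) h23r)) =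
        -(KZ.of ρ' - KZ.of (ρ'.restrict _ hA₁ h1r) - KZ.of (ρ'.restrict _ (hA₂.union hA₃) h23r)) := by
      abel
    rw [this]
    exact KZ.relations.neg_mem hrel
  refine h1.congr (KZ.of_sub_of_mem_relations_of_eqOn (by simp [hdom]) fun z hz => ?_)
  rw [hint z hz]
  exact (hρ'i z).symm

/-! #### 10. Conic normal form and the assembly -/

/-- A polynomial in two variables of total degree `≤ 2` is a conic
`A y² + (b₀ + b₁ x) y + (c₀ + c₁ x + c₂ x²)`. [folklore] -/
theorem exists_conic_of_totalDegree_le_two (P : MvPolynomial (Fin 2) ℚ) (hP : P.totalDegree ≤ 2) :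
    ∃ K : Conic, ∀ z : Fin 2 → ℝ, aeval z P = K.pxy (z 0) (z 1) := by
  classical
  have key : ∀ d ∈ P.support, ∃ K : Conic, ∀ z : Fin 2 → ℝ,
      aeval z (MvPolynomial.monomial d (P.coeff d)) = K.pxy (z 0) (z 1) := by
    intro d hd
    have hdeg : (d.sum fun _ e => e) ≤ 2 := (MvPolynomial.le_totalDegree hd).trans hP
    have hsum : (d.sum fun _ e => e) = d 0 + d 1 := by
      rw [Finsupp.sum_fintype _ _ (fun _ => rfl), Fin.sum_univ_two]
    rw [hsum] at hdeg
    have hev : ∀ z : Fin 2 → ℝ, aeval z (MvPolynomial.monomial d (P.coeff d)) =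
        ((P.coeff d : ℚ) : ℝ) * (z 0 ^ d 0 * z 1 ^ d 1) := fun z => by
      rw [MvPolynomial.aeval_monomial, Finsupp.prod_fintype _ _ (fun _ => by simp),
        Fin.prod_univ_two, eq_ratCast]
    set c := P.coeff d
    have h0 : d 0 ≤ 2 := by omega
    have h1 : d 1 ≤ 2 := by omega
    interval_cases h0' : d 0 <;> interval_cases h1' : d 1
    · exact ⟨⟨0, 0, 0, c, 0, 0⟩, fun z => by rw [hev]; simp [Conic.pxy, Conic.Bx, Conic.Cx]⟩
    · exact ⟨⟨0, c, 0, 0, 0, 0⟩, fun z => by rw [hev]; simp [Conic.pxy, Conic.Bx, Conic.Cx]⟩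
    · exact ⟨⟨c, 0, 0, 0, 0, 0⟩, fun z => by rw [hev]; simp [Conic.pxy, Conic.Bx, Conic.Cx]⟩
    · exact ⟨⟨0, 0, 0, 0, c, 0⟩, fun z => by rw [hev]; simp [Conic.pxy, Conic.Bx, Conic.Cx]⟩
    · exact ⟨⟨0, 0, c, 0, 0, 0⟩, fun z => by
        rw [hev]; simp [Conic.pxy, Conic.Bx, Conic.Cx]; ring⟩
    · omega
    · exact ⟨⟨0, 0, 0, 0, 0, c⟩, fun z => by rw [hev]; simp [Conic.pxy, Conic.Bx, Conic.Cx]⟩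
    · omega
    · omega
  have hsum := fun z : Fin 2 → ℝ => congrArg (aeval z) P.as_sum
  suffices h : ∃ K : Conic, ∀ z : Fin 2 → ℝ,
      aeval z (∑ d ∈ P.support, MvPolynomial.monomial d (P.coeff d)) = K.pxy (z 0) (z 1) by
    obtain ⟨K, hK⟩ := h
    exact ⟨K, fun z => (hsum z).trans (hK z)⟩
  refine Finset.sum_induction _ (fun x : MvPolynomial (Fin 2) ℚ => ∃ K : Conic, ∀ z : Fin 2 → ℝ,
      aeval z x = K.pxy (z 0) (z 1)) (fun a b ha hb => ?_) ⟨⟨0, 0, 0, 0, 0, 0⟩, fun z => by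
        simp [Conic.pxy, Conic.Bx, Conic.Cx]⟩ key
  obtain ⟨K, hK⟩ := ha
  obtain ⟨L, hL⟩ := hb
  exact ⟨K.add L, fun z => by rw [map_add, hK, hL, Conic.add_pxy]⟩

/-- **The conic stratum, modulo square-root descent.** `QuadricBakerDescent` for `d ≤ 2`, given
`SqrtDescent` for all rational `e, f, g, γ`. [this node] -/
theorem quadricBakerDescent_two_of_sqrtDescent (hS : ∀ e f g γ : ℚ, SqrtDescent e f g γ) :
    ∀ (d : ℕ) (P : MvPolynomial (Fin d) ℚ) (q : ℚ) (ρ : KZ.IntegralRep d),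
      (ρ.domain = {x | (∀ j, 0 < x j ∧ x j < 1) ∧ 0 < MvPolynomial.aeval x P} ∧
        ∀ x ∈ ρ.domain, ρ.integrand x = (q : ℝ)) →
      P.totalDegree ≤ 2 → d ≤ 2 →
      ∃ y ∈ AddSubgroup.closure
          {y : KZ.FormalRep | ∃ (m : ℕ) (N : KZ.IntegralRep m), m ≤ 1 ∧ N.IsRational ∧ y = KZ.of N},
        KZ.of ρ - y ∈ KZ.relations := by
  intro d P q ρ hρ hP hd
  obtain ⟨hdom, hint⟩ := hρ
  change InBaker (KZ.of ρ)
  rcases Nat.lt_or_ge d 2 with hd2 | hd2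
  · exact InBaker.of_isRational ρ (by omega)
      ⟨MvPolynomial.C q, 1, fun _ _ => by simp, fun x hx => by simp [hint x hx]⟩
  · obtain rfl : d = 2 := le_antisymm hd hd2
    obtain ⟨K, hK⟩ := exists_conic_of_totalDegree_le_two P hP
    have hdom' : ρ.domain = K.cell := by
      rw [hdom]
      ext z
      simp only [mem_setOf_eq, Conic.cell, hK]
    rcases lt_trichotomy K.A 0 with hA | hA | hA
    · exact inBaker_cell_of_neg K hA q (fun γ => hS _ _ _ γ) ρ hdom' hint
    · exact inBaker_cell_of_zero K hA q ρ hdom' hint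
    · exact inBaker_cell_of_pos K hA q (fun γ => hS _ _ _ γ) ρ hdom' hint

end Summit.KontsevichZagierPeriods.RootDecompWalshStrata.ConicDescent

end
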